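import Mathlib

/-!
# Route `FilamentSkeletonRss` · child crux `TangentSkeletonNearStraightL` (stmt-NavierStokesRegularity-23320) · registered line
# `child_tangent_analytic_strip_L` (b0b56c52900dd90a), stub `stub_stripPropagation` — brick: THE COMPLEXIFIED CHORD NEAR THE DIAGONAL

In the near-diagonal part of the contour shift of `StripPropagation` the source parameter is shifted WITH the target (`σ = z + s`,
`s` real), and the matched kernel is evaluated at the complexified squared chord `Q(z, s) = Σᵢ (Fᵢ(z+s) − Fᵢ(z))²` of the
stadium-analytic extension `F` of one filament.  Because unit speed continues bilinearly (`Σᵢ (F′)ᵢ² ≡ 1`,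
`Theorems.StadiumBilinearUnitSpeed`, p816983), the chord stays quadratically close to `s²`:
* `chord_sq_sub_sq_norm_le` — if `Σᵢ (F′(w))ᵢ² = 1` on an open `U`, the horizontal segment `z + [0, s]` lies in `U` and
  `‖F′(z+r) − F′(z)‖ ≤ ω` along it, then `‖Q(z, s) − s²‖ ≤ 6ω²s²` (exact cancellation of the first-order term: `Σᵢ F′ᵢ(z)·(F′ᵢ(z+r) − F′ᵢ(z))
  = −½ Σᵢ (F′ᵢ(z+r) − F′ᵢ(z))²`);
* `chord_sq_re_ge` — hence `Re Q(z, s) ≥ (1 − 6ω²)·s²`: the kernel `(Q + κ·G)^{-3/2}` is on its principal branch near the diagonal as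
  soon as the tangent modulus `ω` along horizontal lines of the quarter stadium is `< 1/√6` (that modulus — a two-constants estimate on the
  stadium — is the remaining analytic input of the stub and is NOT proved here).
HONEST FRAMING: elementary bricks for a plan about a HYPOTHETICAL filament skeleton on the NEGATIVE side of a MODEL route; the stub
`stub_stripPropagation` is NOT closed; nothing here bears on Navier–Stokes regularity or blow-up.  `--supports stmt-NavierStokesRegularity-23320`.
-/

set_option linter.dupNamespace false

noncomputable section

namespace Summit.NavierStokesRegularity.NavierStokesRegularity.Theorems.StadiumChord

open Set Filter Topology
open scoped BigOperators

/-- **The complexified chord near the diagonal.**  `F : ℂ → ℂ³` complex-differentiable on an open `U` with `Σᵢ (F′(w))ᵢ² = 1` on `U`;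
if the horizontal segment `{z + r : r between 0 and s}` lies in `U` and `‖F′(z+r) − F′(z)‖ ≤ ω` along it, then
`‖Σᵢ (Fᵢ(z+s) − Fᵢ(z))² − s²‖ ≤ 6ω²s²`. [folklore] -/
theorem chord_sq_sub_sq_norm_le {U : Set ℂ} (hU : IsOpen U) {F : ℂ → (Fin 3 → ℂ)} (hF : DifferentiableOn ℂ F U)
    (hunit : ∀ w ∈ U, ∑ i, (deriv F w i) ^ 2 = 1) {z : ℂ} {s ω : ℝ}
    (hseg : ∀ r ∈ Set.uIcc 0 s, z + (r : ℂ) ∈ U)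
    (hω : ∀ r ∈ Set.uIcc 0 s, ‖deriv F (z + (r : ℂ)) - deriv F z‖ ≤ ω) :
    ‖(∑ i, (F (z + (s : ℂ)) i - F z i) ^ 2) - (s : ℂ) ^ 2‖ ≤ 6 * ω ^ 2 * s ^ 2 := by
  set a : ℝ → (Fin 3 → ℂ) := fun r => deriv F (z + (r : ℂ)) with ha
  set a₀ : Fin 3 → ℂ := deriv F z with ha₀
  set d : ℝ → (Fin 3 → ℂ) := fun r => a r - a₀ with hd
  have hz : z ∈ U := by simpa using hseg 0 left_mem_uIcc
  -- continuity of `a` along the segment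
  have hdcont : ContinuousOn (deriv F) U := ((hF.analyticOnNhd hU).deriv).continuousOn
  have hpath_cont : Continuous fun r : ℝ => z + (r : ℂ) := continuous_const.add Complex.continuous_ofReal
  have ha_cont : ContinuousOn a (uIcc 0 s) := hdcont.comp hpath_cont.continuousOn fun r hr => hseg r hr
  have hai_cont : ∀ i, ContinuousOn (fun r => a r i) (uIcc 0 s) := fun i =>
    (continuous_apply i).comp_continuousOn ha_cont
  have hdi_cont : ∀ i, ContinuousOn (fun r => d r i) (uIcc 0 s) := fun i =>
    (hai_cont i).sub continuousOn_const
  -- the derivative of the horizontal path and the fundamental theorem of calculus, coordinatewise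
  have hderiv : ∀ r ∈ uIcc 0 s, HasDerivAt (fun r : ℝ => F (z + (r : ℂ))) (a r) r := by
    intro r hr
    have hFd : HasDerivAt F (deriv F (z + (r : ℂ))) (z + (r : ℂ)) :=
      (hF.differentiableAt (hU.mem_nhds (hseg r hr))).hasDerivAt
    have hp : HasDerivAt (fun r : ℝ => z + (r : ℂ)) ((1 : ℝ) : ℂ) r := ((hasDerivAt_id r).ofReal_comp).const_add z
    have h := hFd.scomp r hp
    rw [Complex.ofReal_one, one_smul] at h
    exact h
  have hFTC : ∀ i, F (z + (s : ℂ)) i - F z i = ∫ r in (0:ℝ)..s, a r i := by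
    intro i
    have hci : ∀ r ∈ uIcc 0 s, HasDerivAt (fun r : ℝ => F (z + (r : ℂ)) i) (a r i) r :=
      fun r hr => (hasDerivAt_pi.1 (hderiv r hr)) i
    have hint : IntervalIntegrable (fun r => a r i) MeasureTheory.volume 0 s := (hai_cont i).intervalIntegrable
    rw [intervalIntegral.integral_eq_sub_of_hasDerivAt hci hint]
    simp
  -- `Vᵢ = s·a₀ᵢ + Dᵢ`
  set D : Fin 3 → ℂ := fun i => ∫ r in (0:ℝ)..s, d r i with hD
  have hV : ∀ i, ∫ r in (0:ℝ)..s, a r i = (s : ℂ) * a₀ i + D i := by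
    intro i
    have h1 : (fun r => a r i) = fun r => a₀ i + d r i := by
      funext r; simp [hd]
    rw [h1, intervalIntegral.integral_add intervalIntegrable_const ((hdi_cont i).intervalIntegrable),
      intervalIntegral.integral_const]
    simp [hD, Complex.real_smul]
  -- unit speed: the first-order term cancels exactly
  have hpt : ∀ r ∈ uIcc 0 s, ∑ i, a₀ i * d r i = -(1/2 : ℂ) * ∑ i, (d r i) ^ 2 := by
    intro r hr
    have h1 : ∑ i, (a r i) ^ 2 = 1 := hunit _ (hseg r hr)
    have h0 : ∑ i, (a₀ i) ^ 2 = 1 := hunit z hz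
    have h2 : ∀ i, a r i = a₀ i + d r i := fun i => by simp [hd]
    simp only [Fin.sum_univ_three] at h1 h0 ⊢
    rw [h2 0, h2 1, h2 2] at h1
    linear_combination (1/2 : ℂ) * h1 - (1/2 : ℂ) * h0
  have hcross : ∑ i, a₀ i * D i = -(1/2 : ℂ) * ∫ r in (0:ℝ)..s, ∑ i, (d r i) ^ 2 := by
    have h1 : ∑ i, a₀ i * D i = ∫ r in (0:ℝ)..s, ∑ i, a₀ i * d r i := by
      rw [intervalIntegral.integral_finsetSum fun i _ => ((hdi_cont i).intervalIntegrable.const_mul (a₀ i))]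
      refine Finset.sum_congr rfl fun i _ => ?_
      simp only [hD]
      exact (intervalIntegral.integral_const_mul (a₀ i) _).symm
    rw [h1, ← intervalIntegral.integral_const_mul]
    exact intervalIntegral.integral_congr fun r hr => hpt r hr
  -- the identity `Q − s² = −s·∫ Σ dᵢ² + Σ Dᵢ²`
  have hsum : (∑ i, (F (z + (s : ℂ)) i - F z i) ^ 2) - (s : ℂ) ^ 2 =
      -(s : ℂ) * (∫ r in (0:ℝ)..s, ∑ i, (d r i) ^ 2) + ∑ i, (D i) ^ 2 := by
    have hVi : ∀ i, F (z + (s : ℂ)) i - F z i = (s : ℂ) * a₀ i + D i := fun i => by rw [hFTC i, hV i]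
    have h0 : ∑ i, (a₀ i) ^ 2 = 1 := hunit z hz
    simp only [Fin.sum_univ_three] at h0 hcross ⊢
    rw [hVi 0, hVi 1, hVi 2]
    linear_combination (s : ℂ) ^ 2 * h0 + 2 * (s : ℂ) * hcross
  -- bounds
  have hdn : ∀ r ∈ uIcc 0 s, ∀ i, ‖d r i‖ ≤ ω := fun r hr i =>
    (norm_le_pi_norm (d r) i).trans (by simpa [hd, ha, ha₀] using hω r hr)
  have hI : ‖∫ r in (0:ℝ)..s, ∑ i, (d r i) ^ 2‖ ≤ 3 * ω ^ 2 * |s| := by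
    have hb : ∀ r ∈ Set.uIoc (0:ℝ) s, ‖∑ i, (d r i) ^ 2‖ ≤ 3 * ω ^ 2 := by
      intro r hr
      have hr' : r ∈ uIcc 0 s := uIoc_subset_uIcc hr
      calc ‖∑ i, (d r i) ^ 2‖ ≤ ∑ i, ‖(d r i) ^ 2‖ := norm_sum_le _ _
        _ ≤ ∑ _i : Fin 3, ω ^ 2 := Finset.sum_le_sum fun i _ => by
            rw [norm_pow]; exact pow_le_pow_left₀ (norm_nonneg _) (hdn r hr' i) 2
        _ = 3 * ω ^ 2 := by simp
    have h := intervalIntegral.norm_integral_le_of_norm_le_const hb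
    simpa [sub_zero] using h
  have hDi : ∀ i, ‖D i‖ ≤ ω * |s| := by
    intro i
    have hb : ∀ r ∈ Set.uIoc (0:ℝ) s, ‖d r i‖ ≤ ω := fun r hr => hdn r (uIoc_subset_uIcc hr) i
    have h := intervalIntegral.norm_integral_le_of_norm_le_const hb
    simpa [hD, sub_zero] using h
  have hω0 : 0 ≤ ω := le_trans (norm_nonneg _) (hdn 0 left_mem_uIcc 0)
  -- assembly
  rw [hsum]
  have h1 : ‖-(s : ℂ) * (∫ r in (0:ℝ)..s, ∑ i, (d r i) ^ 2)‖ ≤ |s| * (3 * ω ^ 2 * |s|) := by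
    rw [norm_mul, norm_neg, Complex.norm_real, Real.norm_eq_abs]
    exact mul_le_mul_of_nonneg_left hI (abs_nonneg s)
  have h2 : ‖∑ i, (D i) ^ 2‖ ≤ ∑ _i : Fin 3, (ω * |s|) ^ 2 :=
    (norm_sum_le _ _).trans (Finset.sum_le_sum fun i _ => by
      rw [norm_pow]; exact pow_le_pow_left₀ (norm_nonneg _) (hDi i) 2)
  have e1 : |s| * (3 * ω ^ 2 * |s|) = 3 * ω ^ 2 * s ^ 2 := by
    have h := abs_mul_abs_self s
    calc |s| * (3 * ω ^ 2 * |s|) = 3 * ω ^ 2 * (|s| * |s|) := by ring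
      _ = 3 * ω ^ 2 * s ^ 2 := by rw [h]; ring
  have e2 : ∑ _i : Fin 3, (ω * |s|) ^ 2 = 3 * ω ^ 2 * s ^ 2 := by
    rw [Finset.sum_const, Finset.card_univ, Fintype.card_fin, nsmul_eq_mul, mul_pow, sq_abs]
    push_cast
    ring
  calc ‖-(s : ℂ) * (∫ r in (0:ℝ)..s, ∑ i, (d r i) ^ 2) + ∑ i, (D i) ^ 2‖
      ≤ ‖-(s : ℂ) * (∫ r in (0:ℝ)..s, ∑ i, (d r i) ^ 2)‖ + ‖∑ i, (D i) ^ 2‖ := norm_add_le _ _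
    _ ≤ |s| * (3 * ω ^ 2 * |s|) + ∑ _i : Fin 3, (ω * |s|) ^ 2 := add_le_add h1 h2
    _ = 6 * ω ^ 2 * s ^ 2 := by rw [e1, e2]; ring

/-- **Principal branch near the diagonal.**  Under the hypotheses of `chord_sq_sub_sq_norm_le`:
`(1 − 6ω²)·s² ≤ Re Σᵢ (Fᵢ(z+s) − Fᵢ(z))²`. [folklore] -/
theorem chord_sq_re_ge {U : Set ℂ} (hU : IsOpen U) {F : ℂ → (Fin 3 → ℂ)} (hF : DifferentiableOn ℂ F U)
    (hunit : ∀ w ∈ U, ∑ i, (deriv F w i) ^ 2 = 1) {z : ℂ} {s ω : ℝ}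
    (hseg : ∀ r ∈ Set.uIcc 0 s, z + (r : ℂ) ∈ U)
    (hω : ∀ r ∈ Set.uIcc 0 s, ‖deriv F (z + (r : ℂ)) - deriv F z‖ ≤ ω) :
    (1 - 6 * ω ^ 2) * s ^ 2 ≤ (∑ i, (F (z + (s : ℂ)) i - F z i) ^ 2).re := by
  have h := chord_sq_sub_sq_norm_le hU hF hunit hseg hω
  set Q : ℂ := ∑ i, (F (z + (s : ℂ)) i - F z i) ^ 2 with hQ
  have hre : Q.re = s ^ 2 + (Q - (s : ℂ) ^ 2).re := by
    simp [Complex.sub_re, ← Complex.ofReal_pow]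
  have hlow : -(6 * ω ^ 2 * s ^ 2) ≤ (Q - (s : ℂ) ^ 2).re := by
    have h1 := Complex.abs_re_le_norm (Q - (s : ℂ) ^ 2)
    have h2 := neg_abs_le (Q - (s : ℂ) ^ 2).re
    linarith
  rw [hre]
  linarith

/-! ## Appended (same hand): the chord about an ARBITRARY reference vector

The cancellation of the first-order term does not need the reference vector to be a value of `F′`: for ANY `t̄ ∈ ℂ³` and
`e(r) = F′(z+r) − t̄`, unit speed `Σᵢ (t̄ᵢ + eᵢ(r))² = 1` gives `2Σᵢ t̄ᵢ eᵢ(r) = 1 − Σᵢ t̄ᵢ² − Σᵢ eᵢ(r)²`, and the chord is again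
`Q − s² = −s·∫₀ˢ Σᵢ eᵢ² + Σᵢ (∫₀ˢ eᵢ)²`.  So `‖Q − s²‖ ≤ 6η²s²` with `η = sup_r ‖F′(z+r) − t̄‖` — in the application `t̄` is the (real) mean
tangent direction and `η` comes straight from the two-constants estimate (`Theorems.StadiumTwoConstants`), which is four times sharper than going
through the endpoint value `F′(z)`. -/

/-- **The complexified chord about an arbitrary reference vector.**  `F : ℂ → ℂ³` complex-differentiable on an open `U` with
`Σᵢ (F′(w))ᵢ² = 1` on `U`; if the horizontal segment `{z + r}` (`r` between `0` and `s`) lies in `U` and `‖F′(z+r) − t̄‖ ≤ η` along it for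
some fixed `t̄ : ℂ³`, then `‖Σᵢ (Fᵢ(z+s) − Fᵢ(z))² − s²‖ ≤ 6η²s²`. [folklore] -/
theorem chord_sq_sub_sq_norm_le_of_near_const {U : Set ℂ} (hU : IsOpen U) {F : ℂ → (Fin 3 → ℂ)} (hF : DifferentiableOn ℂ F U)
    (hunit : ∀ w ∈ U, ∑ i, (deriv F w i) ^ 2 = 1) {z : ℂ} {s η : ℝ} (tbar : Fin 3 → ℂ)
    (hseg : ∀ r ∈ Set.uIcc 0 s, z + (r : ℂ) ∈ U)
    (hη : ∀ r ∈ Set.uIcc 0 s, ‖deriv F (z + (r : ℂ)) - tbar‖ ≤ η) :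
    ‖(∑ i, (F (z + (s : ℂ)) i - F z i) ^ 2) - (s : ℂ) ^ 2‖ ≤ 6 * η ^ 2 * s ^ 2 := by
  set a : ℝ → (Fin 3 → ℂ) := fun r => deriv F (z + (r : ℂ)) with ha
  set d : ℝ → (Fin 3 → ℂ) := fun r => a r - tbar with hd
  -- continuity of `a` along the segment
  have hdcont : ContinuousOn (deriv F) U := ((hF.analyticOnNhd hU).deriv).continuousOn
  have hpath_cont : Continuous fun r : ℝ => z + (r : ℂ) := continuous_const.add Complex.continuous_ofReal
  have ha_cont : ContinuousOn a (uIcc 0 s) := hdcont.comp hpath_cont.continuousOn fun r hr => hseg r hr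
  have hai_cont : ∀ i, ContinuousOn (fun r => a r i) (uIcc 0 s) := fun i =>
    (continuous_apply i).comp_continuousOn ha_cont
  have hdi_cont : ∀ i, ContinuousOn (fun r => d r i) (uIcc 0 s) := fun i =>
    (hai_cont i).sub continuousOn_const
  -- the fundamental theorem of calculus, coordinatewise
  have hderiv : ∀ r ∈ uIcc 0 s, HasDerivAt (fun r : ℝ => F (z + (r : ℂ))) (a r) r := by
    intro r hr
    have hFd : HasDerivAt F (deriv F (z + (r : ℂ))) (z + (r : ℂ)) :=
      (hF.differentiableAt (hU.mem_nhds (hseg r hr))).hasDerivAt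
    have hp : HasDerivAt (fun r : ℝ => z + (r : ℂ)) ((1 : ℝ) : ℂ) r := ((hasDerivAt_id r).ofReal_comp).const_add z
    have h := hFd.scomp r hp
    rw [Complex.ofReal_one, one_smul] at h
    exact h
  have hFTC : ∀ i, F (z + (s : ℂ)) i - F z i = ∫ r in (0:ℝ)..s, a r i := by
    intro i
    have hci : ∀ r ∈ uIcc 0 s, HasDerivAt (fun r : ℝ => F (z + (r : ℂ)) i) (a r i) r :=
      fun r hr => (hasDerivAt_pi.1 (hderiv r hr)) i
    have hint : IntervalIntegrable (fun r => a r i) MeasureTheory.volume 0 s := (hai_cont i).intervalIntegrable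
    rw [intervalIntegral.integral_eq_sub_of_hasDerivAt hci hint]
    simp
  -- `Vᵢ = s·t̄ᵢ + Dᵢ`
  set D : Fin 3 → ℂ := fun i => ∫ r in (0:ℝ)..s, d r i with hD
  have hV : ∀ i, ∫ r in (0:ℝ)..s, a r i = (s : ℂ) * tbar i + D i := by
    intro i
    have h1 : (fun r => a r i) = fun r => tbar i + d r i := by
      funext r; simp [hd]
    rw [h1, intervalIntegral.integral_add intervalIntegrable_const ((hdi_cont i).intervalIntegrable),
      intervalIntegral.integral_const]
    simp [hD, Complex.real_smul]
  -- unit speed: `Σ t̄ᵢ dᵢ(r) = ½ − ½Σ t̄ᵢ² − ½ Σ dᵢ(r)²`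
  have hpt : ∀ r ∈ uIcc 0 s, ∑ i, tbar i * d r i = (1/2 : ℂ) - (1/2 : ℂ) * ∑ i, (tbar i) ^ 2 - (1/2 : ℂ) * ∑ i, (d r i) ^ 2 := by
    intro r hr
    have h1 : ∑ i, (a r i) ^ 2 = 1 := hunit _ (hseg r hr)
    have h2 : ∀ i, a r i = tbar i + d r i := fun i => by simp [hd]
    simp only [Fin.sum_univ_three] at h1 ⊢
    rw [h2 0, h2 1, h2 2] at h1
    linear_combination (1/2 : ℂ) * h1
  have hcross : ∑ i, tbar i * D i =
      (s : ℂ) * ((1/2 : ℂ) - (1/2 : ℂ) * ∑ i, (tbar i) ^ 2) - (1/2 : ℂ) * ∫ r in (0:ℝ)..s, ∑ i, (d r i) ^ 2 := by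
    have hSint : IntervalIntegrable (fun r => ∑ i, (d r i) ^ 2) MeasureTheory.volume 0 s :=
      (ContinuousOn.intervalIntegrable (continuousOn_finsetSum _ fun i _ => (hdi_cont i).pow 2))
    have h1 : ∑ i, tbar i * D i = ∫ r in (0:ℝ)..s, ∑ i, tbar i * d r i := by
      rw [intervalIntegral.integral_finsetSum fun i _ => ((hdi_cont i).intervalIntegrable.const_mul (tbar i))]
      refine Finset.sum_congr rfl fun i _ => ?_
      simp only [hD]
      exact (intervalIntegral.integral_const_mul (tbar i) _).symm
    have h2 : ∫ r in (0:ℝ)..s, ∑ i, tbar i * d r i =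
        ∫ r in (0:ℝ)..s, (((1/2 : ℂ) - (1/2 : ℂ) * ∑ i, (tbar i) ^ 2) - (1/2 : ℂ) * ∑ i, (d r i) ^ 2) :=
      intervalIntegral.integral_congr fun r hr => hpt r hr
    rw [h1, h2, intervalIntegral.integral_sub intervalIntegrable_const (hSint.const_mul _),
      intervalIntegral.integral_const, intervalIntegral.integral_const_mul]
    simp [Complex.real_smul]
  -- the identity `Q − s² = −s·∫ Σ dᵢ² + Σ Dᵢ²`
  have hsum : (∑ i, (F (z + (s : ℂ)) i - F z i) ^ 2) - (s : ℂ) ^ 2 =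
      -(s : ℂ) * (∫ r in (0:ℝ)..s, ∑ i, (d r i) ^ 2) + ∑ i, (D i) ^ 2 := by
    have hVi : ∀ i, F (z + (s : ℂ)) i - F z i = (s : ℂ) * tbar i + D i := fun i => by rw [hFTC i, hV i]
    simp only [Fin.sum_univ_three] at hcross ⊢
    rw [hVi 0, hVi 1, hVi 2]
    linear_combination 2 * (s : ℂ) * hcross
  -- bounds
  have hdn : ∀ r ∈ uIcc 0 s, ∀ i, ‖d r i‖ ≤ η := fun r hr i =>
    (norm_le_pi_norm (d r) i).trans (by simpa [hd, ha] using hη r hr)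
  have hI : ‖∫ r in (0:ℝ)..s, ∑ i, (d r i) ^ 2‖ ≤ 3 * η ^ 2 * |s| := by
    have hb : ∀ r ∈ Set.uIoc (0:ℝ) s, ‖∑ i, (d r i) ^ 2‖ ≤ 3 * η ^ 2 := by
      intro r hr
      have hr' : r ∈ uIcc 0 s := uIoc_subset_uIcc hr
      calc ‖∑ i, (d r i) ^ 2‖ ≤ ∑ i, ‖(d r i) ^ 2‖ := norm_sum_le _ _
        _ ≤ ∑ _i : Fin 3, η ^ 2 := Finset.sum_le_sum fun i _ => by
            rw [norm_pow]; exact pow_le_pow_left₀ (norm_nonneg _) (hdn r hr' i) 2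
        _ = 3 * η ^ 2 := by simp
    have h := intervalIntegral.norm_integral_le_of_norm_le_const hb
    simpa [sub_zero] using h
  have hDi : ∀ i, ‖D i‖ ≤ η * |s| := by
    intro i
    have hb : ∀ r ∈ Set.uIoc (0:ℝ) s, ‖d r i‖ ≤ η := fun r hr => hdn r (uIoc_subset_uIcc hr) i
    have h := intervalIntegral.norm_integral_le_of_norm_le_const hb
    simpa [hD, sub_zero] using h
  rw [hsum]
  have h1 : ‖-(s : ℂ) * (∫ r in (0:ℝ)..s, ∑ i, (d r i) ^ 2)‖ ≤ |s| * (3 * η ^ 2 * |s|) := by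
    rw [norm_mul, norm_neg, Complex.norm_real, Real.norm_eq_abs]
    exact mul_le_mul_of_nonneg_left hI (abs_nonneg s)
  have h2 : ‖∑ i, (D i) ^ 2‖ ≤ ∑ _i : Fin 3, (η * |s|) ^ 2 :=
    (norm_sum_le _ _).trans (Finset.sum_le_sum fun i _ => by
      rw [norm_pow]; exact pow_le_pow_left₀ (norm_nonneg _) (hDi i) 2)
  have e1 : |s| * (3 * η ^ 2 * |s|) = 3 * η ^ 2 * s ^ 2 := by
    have h := abs_mul_abs_self s
    calc |s| * (3 * η ^ 2 * |s|) = 3 * η ^ 2 * (|s| * |s|) := by ring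
      _ = 3 * η ^ 2 * s ^ 2 := by rw [h]; ring
  have e2 : ∑ _i : Fin 3, (η * |s|) ^ 2 = 3 * η ^ 2 * s ^ 2 := by
    rw [Finset.sum_const, Finset.card_univ, Fintype.card_fin, nsmul_eq_mul, mul_pow, sq_abs]
    push_cast
    ring
  calc ‖-(s : ℂ) * (∫ r in (0:ℝ)..s, ∑ i, (d r i) ^ 2) + ∑ i, (D i) ^ 2‖
      ≤ ‖-(s : ℂ) * (∫ r in (0:ℝ)..s, ∑ i, (d r i) ^ 2)‖ + ‖∑ i, (D i) ^ 2‖ := norm_add_le _ _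
    _ ≤ |s| * (3 * η ^ 2 * |s|) + ∑ _i : Fin 3, (η * |s|) ^ 2 := add_le_add h1 h2
    _ = 6 * η ^ 2 * s ^ 2 := by rw [e1, e2]; ring

/-- **Principal branch near the diagonal, arbitrary reference vector.**  Under the hypotheses of
`chord_sq_sub_sq_norm_le_of_near_const`: `(1 − 6η²)·s² ≤ Re Σᵢ (Fᵢ(z+s) − Fᵢ(z))²`. [folklore] -/
theorem chord_sq_re_ge_of_near_const {U : Set ℂ} (hU : IsOpen U) {F : ℂ → (Fin 3 → ℂ)} (hF : DifferentiableOn ℂ F U)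
    (hunit : ∀ w ∈ U, ∑ i, (deriv F w i) ^ 2 = 1) {z : ℂ} {s η : ℝ} (tbar : Fin 3 → ℂ)
    (hseg : ∀ r ∈ Set.uIcc 0 s, z + (r : ℂ) ∈ U)
    (hη : ∀ r ∈ Set.uIcc 0 s, ‖deriv F (z + (r : ℂ)) - tbar‖ ≤ η) :
    (1 - 6 * η ^ 2) * s ^ 2 ≤ (∑ i, (F (z + (s : ℂ)) i - F z i) ^ 2).re := by
  have h := chord_sq_sub_sq_norm_le_of_near_const hU hF hunit tbar hseg hη
  set Q : ℂ := ∑ i, (F (z + (s : ℂ)) i - F z i) ^ 2 with hQ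
  have hre : Q.re = s ^ 2 + (Q - (s : ℂ) ^ 2).re := by
    simp [Complex.sub_re, ← Complex.ofReal_pow]
  have hlow : -(6 * η ^ 2 * s ^ 2) ≤ (Q - (s : ℂ) ^ 2).re := by
    have h1 := Complex.abs_re_le_norm (Q - (s : ℂ) ^ 2)
    have h2 := neg_abs_le (Q - (s : ℂ) ^ 2).re
    linarith
  rw [hre]
  linarith

end Summit.NavierStokesRegularity.NavierStokesRegularity.Theorems.StadiumChord

end
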